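import Mathlib
import Summits.AtomisticToContinuum.HydrodynamicLimit.Theorems.ImplosionDichotomyDenseExcursionPackingAnalyticSonicExistence
import Summits.AtomisticToContinuum.HydrodynamicLimit.Theorems.ImplosionDichotomyDenseExcursionPackingAnalyticSonicRealUnique
import Summits.AtomisticToContinuum.HydrodynamicLimit.Theorems.ImplosionDichotomyDenseExcursionSonicSlavingAnalyticProfile

/-!
# THE SONIC-WINDOW ANALYTIC BOUND of the order-`k` packing problem: holomorphic extension of the real window solution to
# the complex sonic triangle with a `k`-uniform sup bound
# (crux `DenseExcursion`, stmt-AtomisticToContinuum-12586, line `sonic-cavity-renewal` v9, stub `stub_analyticPackingImplosion`)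

Helper file (`--supports stmt-AtomisticToContinuum-12586`, line lead a2, wave-5 worker D2; the registered target
`sonicWindow_analytic_bound` of task (1) of the workers D/D1/D2, reports `work/stubs/D1_gammaClosure.REPORT.md` §3 and
`D2_triangle.REPORT.md`). For `Λ ≥ Λ₀`, `0 < ρ ≤ ρ₀` (profile-dependent only), holomorphic sources `f₁, f₂` on the sonic
triangle `𝒟_ρ = {−3ρ < Re z < ρ, |Im z| < (Re z + 3ρ)/2}` bounded by `N` and REAL on the real window, and ANY differentiable
real solution `(u₁, u₂)` on `(−3ρ, ρ)` of the real resolvent equations `Λu − Lu = Re f` bounded by `R` there: the solution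
extends to a holomorphic pair `(U₁, U₂)` on `𝒟_ρ` with `‖U₁ z‖ + ‖U₂ z‖ ≤ C (R + N/Λ)` — NO `e^{cΛ}` loss. Assembly of
`cavityTube_complex_extension` (holomorphic profile), `sonicTriangle_holomorphic_existence` (a bounded holomorphic solution
with the right value of `U₁ − 3U₂` at the sonic point), `sonicWindow_real_unique` (its real trace IS the given real solution:
real and imaginary parts of the difference solve the homogeneous real characteristic system with `M(0) = 0`), and
`sonicTriangle_apriori_bound`.

Sources: Nirenberg 1972 (abstract Cauchy–Kovalevskaya in sup norms); standard. NOT here: the sources of order `k` or `Γ`.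
-/

noncomputable section

open Set Metric Filter Topology

namespace Summit.AtomisticToContinuum.HydrodynamicLimit.Theorems.PackingAnalyticImplosion

open Summit.AtomisticToContinuum.HydrodynamicLimit.Theorems.R2OneModeTwoConditions
open Summit.AtomisticToContinuum.HydrodynamicLimit.Theorems.SonicCavityRenewal

set_option maxHeartbeats 1600000 in -- one declaration: existence + identification (re/im) + a-priori bound
/-- **THE SONIC-WINDOW ANALYTIC BOUND** (registered helper `sonicWindow_analytic_bound` of `stub_analyticPackingImplosion`):
holomorphic extension of the real window solution of the order-`k` packing problem to the sonic triangle, with the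
`k`-uniform bound `‖U₁‖ + ‖U₂‖ ≤ C (sup_window (|u₁| + |u₂|) + sup_triangle ‖f‖/Λ)`. [folklore] -/
theorem sonicWindow_analytic_bound : ∀ (r : ℝ) (W S : ℝ → ℝ), IsMonatomicProfile r W S → CavityTube r W S → ∃ (ρ₀ Λ₀ C : ℝ), 0 < ρ₀ ∧ 0 < Λ₀ ∧ 0 < C ∧ ∀ (Λ ρ : ℝ), Λ₀ ≤ Λ → 0 < ρ → ρ ≤ ρ₀ → ∀ (f₁ f₂ : ℂ → ℂ) (u₁ u₂ : ℝ → ℝ) (N R : ℝ), DifferentiableOn ℂ f₁ {z : ℂ | -(3 * ρ) < z.re ∧ z.re < ρ ∧ |z.im| < (z.re + 3 * ρ) / 2} → DifferentiableOn ℂ f₂ {z : ℂ | -(3 * ρ) < z.re ∧ z.re < ρ ∧ |z.im| < (z.re + 3 * ρ) / 2} → (∀ z ∈ {z : ℂ | -(3 * ρ) < z.re ∧ z.re < ρ ∧ |z.im| < (z.re + 3 * ρ) / 2}, ‖f₁ z‖ ≤ N ∧ ‖f₂ z‖ ≤ N) → (∀ x ∈ Set.Ioo (-(3 * ρ)) ρ,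 (f₁ x).im = 0 ∧ (f₂ x).im = 0) → (∀ x ∈ Set.Ioo (-(3 * ρ)) ρ, DifferentiableAt ℝ u₁ x ∧ DifferentiableAt ℝ u₂ x) → (∀ x ∈ Set.Ioo (-(3 * ρ)) ρ, Λ * u₁ x - ((W x - 1) * deriv u₁ x + 3 * S x * deriv u₂ x + (deriv W x + 2 * W x - r) * u₁ x + (3 * deriv S x + 6 * S x) * u₂ x) = (f₁ x).re ∧ Λ * u₂ x - (S x / 3 * deriv u₁ x + (W x - 1) * deriv u₂ x + (deriv S x + 2 * S x) * u₁ x + (deriv W x / 3 + 2 * W x - r) * u₂ x) = (f₂ x).re) → (∀ x ∈ Set.Ioo (-(3 * ρ)) ρ, |u₁ x| + |u₂ x| ≤ R) → ∃ U₁ U₂ : ℂ → ℂ, DifferentiableOn ℂ U₁ {z : ℂ | -(3 * ρ) < z.re ∧ z.re < ρ ∧ |z.im| < (z.re + 3 * ρ) / 2} ∧ DifferentiableOn ℂ U₂ {z : ℂ | -(3 * ρ) < z.re ∧ z.re < ρ ∧ |z.im| < (z.re + 3 * ρ) / 2} ∧ (∀ x ∈ Set.Ioo (-(3 * ρ)) ρ,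 U₁ x = u₁ x ∧ U₂ x = u₂ x) ∧ ∀ z ∈ {z : ℂ | -(3 * ρ) < z.re ∧ z.re < ρ ∧ |z.im| < (z.re + 3 * ρ) / 2}, ‖U₁ z‖ + ‖U₂ z‖ ≤ C * (R + N / Λ) := by
  intro r W S hprof htube
  obtain ⟨Wc, Sc, hWc, hSc, hext⟩ := cavityTube_complex_extension r W S hprof htube
  obtain ⟨ρa, Λa, C, hρa, hΛa, hC, hapr⟩ := sonicTriangle_apriori_bound r W S Wc Sc hprof htube hWc hSc hext
  obtain ⟨ρe, Λe, hρe, hΛe, hexi⟩ := sonicTriangle_holomorphic_existence r W S Wc Sc hprof htube hWc hSc hext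
  obtain ⟨ρu, Λu, hρu, hΛu, huni⟩ := sonicWindow_real_unique r W S Wc Sc hprof htube hWc hSc hext
  refine ⟨min (min ρa ρe) (min ρu (1 / 30)), max Λa (max Λe Λu), C,
    lt_min (lt_min hρa hρe) (lt_min hρu (by norm_num)), lt_max_of_lt_left hΛa, hC, ?_⟩
  intro Λ ρ hΛ hρ hρ₀ f₁ f₂ u₁ u₂ N R hf₁ hf₂ hN hfim hud hueq huR
  have hΛa' : Λa ≤ Λ := (le_max_left _ _).trans hΛ
  have hΛe' : Λe ≤ Λ := ((le_max_left _ _).trans (le_max_right _ _)).trans hΛ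
  have hΛu' : Λu ≤ Λ := ((le_max_right _ _).trans (le_max_right _ _)).trans hΛ
  have hρa' : ρ ≤ ρa := hρ₀.trans ((min_le_left _ _).trans (min_le_left _ _))
  have hρe' : ρ ≤ ρe := hρ₀.trans ((min_le_left _ _).trans (min_le_right _ _))
  have hρu' : ρ ≤ ρu := hρ₀.trans ((min_le_right _ _).trans (min_le_left _ _))
  have hρ30 : ρ ≤ 1 / 30 := hρ₀.trans ((min_le_right _ _).trans (min_le_right _ _))
  set D : Set ℂ := {z : ℂ | -(3 * ρ) < z.re ∧ z.re < ρ ∧ |z.im| < (z.re + 3 * ρ) / 2} with hD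
  have hDo : IsOpen D := isOpen_sonicTriangle ρ
  have hxD : ∀ x ∈ Ioo (-(3 * ρ)) ρ, (x : ℂ) ∈ D := fun x hx => ofReal_mem_sonicTriangle hx.1 hx.2
  have hx10 : ∀ x ∈ Ioo (-(3 * ρ)) ρ, |x| < 1 / 10 := fun x hx => by
    rw [abs_lt]; constructor <;> linarith [hx.1, hx.2]
  have h0I : (0 : ℝ) ∈ Ioo (-(3 * ρ)) ρ := ⟨by linarith, hρ⟩
  -- STEP A: a bounded holomorphic solution with the right value of `U₁ - 3 U₂` at the sonic point
  obtain ⟨U₁, U₂, hU₁, hU₂, hbdd, hm₀, hsol⟩ := hexi Λ ρ hΛe' hρ hρe' f₁ f₂ (((u₁ 0 - 3 * u₂ 0 : ℝ)) : ℂ) hf₁ hf₂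
    ⟨N, hN⟩
  -- STEP B: the difference `δᵢ x = Uᵢ x - uᵢ x` solves the homogeneous characteristic system on the window
  set δ₁ : ℝ → ℂ := fun x => U₁ (x : ℂ) - ((u₁ x : ℝ) : ℂ) with hδ₁
  set δ₂ : ℝ → ℂ := fun x => U₂ (x : ℂ) - ((u₂ x : ℝ) : ℂ) with hδ₂
  set bpp : ℝ → ℝ := fun x => 2 / 3 * deriv W x + 2 * W x - r + 2 * deriv S x + 4 * S x with hbpp
  set bpm : ℝ → ℝ := fun x => deriv W x / 3 + deriv S x + 2 * S x with hbpm
  set bmm : ℝ → ℝ := fun x => 2 / 3 * deriv W x + 2 * W x - r - 2 * deriv S x - 4 * S x with hbmm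
  set bmp : ℝ → ℝ := fun x => deriv W x / 3 - deriv S x - 2 * S x with hbmp
  have hδd : ∀ x ∈ Ioo (-(3 * ρ)) ρ, HasDerivAt δ₁ (deriv U₁ (x : ℂ) - ((deriv u₁ x : ℝ) : ℂ)) x ∧
      HasDerivAt δ₂ (deriv U₂ (x : ℂ) - ((deriv u₂ x : ℝ) : ℂ)) x := by
    intro x hx
    have h1 : HasDerivAt U₁ (deriv U₁ (x : ℂ)) (x : ℂ) := (hU₁.differentiableAt (hDo.mem_nhds (hxD x hx))).hasDerivAt
    have h2 : HasDerivAt U₂ (deriv U₂ (x : ℂ)) (x : ℂ) := (hU₂.differentiableAt (hDo.mem_nhds (hxD x hx))).hasDerivAt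
    exact ⟨h1.comp_ofReal.sub (hud x hx).1.hasDerivAt.ofReal_comp, h2.comp_ofReal.sub (hud x hx).2.hasDerivAt.ofReal_comp⟩
  have hδeq : ∀ x ∈ Ioo (-(3 * ρ)) ρ,
      ((W x - 1 + S x : ℝ) : ℂ) * ((deriv U₁ (x : ℂ) - ((deriv u₁ x : ℝ) : ℂ)) + 3 * (deriv U₂ (x : ℂ) - ((deriv u₂ x : ℝ) : ℂ))) =
        ((Λ - bpp x : ℝ) : ℂ) * (δ₁ x + 3 * δ₂ x) - ((bpm x : ℝ) : ℂ) * (δ₁ x - 3 * δ₂ x) ∧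
      ((W x - 1 - S x : ℝ) : ℂ) * ((deriv U₁ (x : ℂ) - ((deriv u₁ x : ℝ) : ℂ)) - 3 * (deriv U₂ (x : ℂ) - ((deriv u₂ x : ℝ) : ℂ))) =
        ((Λ - bmm x : ℝ) : ℂ) * (δ₁ x - 3 * δ₂ x) - ((bmp x : ℝ) : ℂ) * (δ₁ x + 3 * δ₂ x) := by
    intro x hx
    obtain ⟨eW, eS, eW', eS'⟩ := hext x (hx10 x hx)
    obtain ⟨hc1, hc2⟩ := hsol (x : ℂ) (hxD x hx)
    rw [eW, eS, eW', eS'] at hc1 hc2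
    obtain ⟨hr1, hr2⟩ := hueq x hx
    have hr1c := congrArg Complex.ofReal hr1
    have hr2c := congrArg Complex.ofReal hr2
    have hf1 : (((f₁ (x : ℂ)).re : ℝ) : ℂ) = f₁ (x : ℂ) := Complex.ext (by simp) (by simp [(hfim x hx).1])
    have hf2 : (((f₂ (x : ℂ)).re : ℝ) : ℂ) = f₂ (x : ℂ) := Complex.ext (by simp) (by simp [(hfim x hx).2])
    push_cast at hr1c hr2c
    rw [hf1] at hr1c; rw [hf2] at hr2c
    simp only [hδ₁, hδ₂, hbpp, hbpm, hbmm, hbmp]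
    push_cast
    constructor
    · linear_combination (-1 : ℂ) * hc1 + hr1c - 3 * hc2 + 3 * hr2c
    · linear_combination (-1 : ℂ) * hc1 + hr1c + 3 * hc2 - 3 * hr2c
  have hδ0 : δ₁ 0 - 3 * δ₂ 0 = 0 := by
    have hm₀' := hm₀
    simp only [hδ₁, hδ₂, Complex.ofReal_zero]
    push_cast at hm₀' ⊢
    linear_combination hm₀'
  -- STEP C: real and imaginary parts vanish by `sonicWindow_real_unique`
  have key : ∀ ℓ : ℂ →L[ℝ] ℝ, (∀ (a : ℝ) (z : ℂ), ℓ ((a : ℂ) * z) = a * ℓ z) →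
      ∀ x ∈ Ioo (-(3 * ρ)) ρ, ℓ (δ₁ x + 3 * δ₂ x) = 0 ∧ ℓ (δ₁ x - 3 * δ₂ x) = 0 := by
    intro ℓ hℓ
    set p : ℝ → ℝ := fun x => ℓ (δ₁ x + 3 * δ₂ x) with hp
    set m : ℝ → ℝ := fun x => ℓ (δ₁ x - 3 * δ₂ x) with hm
    have hpm : ∀ x ∈ Ioo (-(3 * ρ)) ρ,
        HasDerivAt p (ℓ ((deriv U₁ (x : ℂ) - ((deriv u₁ x : ℝ) : ℂ)) + 3 * (deriv U₂ (x : ℂ) - ((deriv u₂ x : ℝ) : ℂ)))) x ∧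
        HasDerivAt m (ℓ ((deriv U₁ (x : ℂ) - ((deriv u₁ x : ℝ) : ℂ)) - 3 * (deriv U₂ (x : ℂ) - ((deriv u₂ x : ℝ) : ℂ)))) x := by
      intro x hx
      obtain ⟨h1, h2⟩ := hδd x hx
      exact ⟨ℓ.hasFDerivAt.comp_hasDerivAt x (h1.add (h2.const_mul 3)), ℓ.hasFDerivAt.comp_hasDerivAt x (h1.sub (h2.const_mul 3))⟩
    have h3 : ∀ z : ℂ, ℓ (3 * z) = 3 * ℓ z := fun z => by simpa using hℓ 3 z
    have hdiffpm : ∀ x ∈ Ioo (-(3 * ρ)) ρ, DifferentiableAt ℝ p x ∧ DifferentiableAt ℝ m x := fun x hx =>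
      ⟨(hpm x hx).1.differentiableAt, (hpm x hx).2.differentiableAt⟩
    have heqpm : ∀ x ∈ Ioo (-(3 * ρ)) ρ, (W x - 1 + S x) * deriv p x = (Λ - (2 / 3 * deriv W x + 2 * W x - r +
        2 * deriv S x + 4 * S x)) * p x - (deriv W x / 3 + deriv S x + 2 * S x) * m x ∧
        (W x - 1 - S x) * deriv m x = (Λ - (2 / 3 * deriv W x + 2 * W x - r - 2 * deriv S x - 4 * S x)) * m x -
        (deriv W x / 3 - deriv S x - 2 * S x) * p x := by
      intro x hx
      obtain ⟨e1, e2⟩ := hδeq x hx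
      rw [(hpm x hx).1.deriv, (hpm x hx).2.deriv]
      have k1 := congrArg ℓ e1
      have k2 := congrArg ℓ e2
      rw [hℓ, map_sub ℓ (((Λ - bpp x : ℝ) : ℂ) * (δ₁ x + 3 * δ₂ x)) (((bpm x : ℝ) : ℂ) * (δ₁ x - 3 * δ₂ x)), hℓ, hℓ] at k1
      rw [hℓ, map_sub ℓ (((Λ - bmm x : ℝ) : ℂ) * (δ₁ x - 3 * δ₂ x)) (((bmp x : ℝ) : ℂ) * (δ₁ x + 3 * δ₂ x)), hℓ, hℓ] at k2
      simp only [hp, hm, hbpp, hbpm, hbmm, hbmp] at k1 k2 ⊢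
      exact ⟨by linear_combination k1, by linear_combination k2⟩
    have hm0 : m 0 = 0 := by simp only [hm]; rw [hδ0, map_zero]
    exact huni Λ ρ hΛu' hρ hρu' p m hdiffpm heqpm hm0
  have hre := key Complex.reCLM (fun a z => by simp)
  have him := key Complex.imCLM (fun a z => by simp)
  have hδzero : ∀ x ∈ Ioo (-(3 * ρ)) ρ, δ₁ x = 0 ∧ δ₂ x = 0 := by
    intro x hx
    obtain ⟨r1, r2⟩ := hre x hx
    obtain ⟨i1, i2⟩ := him x hx
    simp only [Complex.reCLM_apply, Complex.imCLM_apply] at r1 r2 i1 i2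
    have hP : δ₁ x + 3 * δ₂ x = 0 := Complex.ext (by simpa using r1) (by simpa using i1)
    have hM : δ₁ x - 3 * δ₂ x = 0 := Complex.ext (by simpa using r2) (by simpa using i2)
    constructor
    · linear_combination (1 / 2 : ℂ) * hP + (1 / 2 : ℂ) * hM
    · linear_combination (1 / 6 : ℂ) * hP - (1 / 6 : ℂ) * hM
  have htrace : ∀ x ∈ Ioo (-(3 * ρ)) ρ, U₁ (x : ℂ) = ((u₁ x : ℝ) : ℂ) ∧ U₂ (x : ℂ) = ((u₂ x : ℝ) : ℂ) := fun x hx =>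
    ⟨sub_eq_zero.1 (hδzero x hx).1, sub_eq_zero.1 (hδzero x hx).2⟩
  -- STEP D: the a-priori bound
  refine ⟨U₁, U₂, hU₁, hU₂, htrace, ?_⟩
  refine hapr Λ ρ hΛa' hρ hρa' U₁ U₂ N R hU₁ hU₂ hbdd (fun z hz => ?_) (fun x h1 h2 => ?_)
  · obtain ⟨e1, e2⟩ := hsol z hz
    rw [e1, e2]; exact hN z hz
  · obtain ⟨t1, t2⟩ := htrace x ⟨h1, h2⟩
    rw [t1, t2, Complex.norm_real, Complex.norm_real, Real.norm_eq_abs, Real.norm_eq_abs]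
    exact huR x ⟨h1, h2⟩

end Summit.AtomisticToContinuum.HydrodynamicLimit.Theorems.PackingAnalyticImplosion

end
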